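import Literature.MathematicalPhysics.QuantumFieldTheory.Balaban1983to89.T3CurvGradLog
import HarnessLib

/-!
# `Balaban1983to89.T3UpperLiftSplitLog` — rung R3, crux K1, child «MinimiserStabilityRegPr» (stmt-QuantumFields-19200): UPPER's regular-lift composition
# RE-DERIVED from the log-Lipschitz schema `T3CurvGradLog.MinimiserCurvGradLogAt` in place of the `β₀ = 1` schema `MinimiserCurvGradAt`
# (`regularLiftAlongMinimisersAt_of_splitLog`, `upperAlongRegPrMinimisersAt_of_splitLog'`)

Cell `ym3-torus` (HUMAN RULING D-0037, YM ladder rung R3), seat `ym3-torus-p1` gen 12; cell record HOME/UV3-NODE.md §21 (finding F-g12-1).  The proof is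
`T3UpperLiftSplit.regularLiftAlongMinimisersAt_of_split` with the gradient input `b = B₄θ((K − ⌊K/m⌋) + 1)L^{−3(K−⌊K/m⌋)}` (`(K − ⌊K/m⌋) + 1 ≤ K + 2`): every
threshold through `b` becomes «`(K + 2)θ ≤ σ`», closed by `T3CurvGradLog.exists_gamma_forall_Kmul_θBal_le` (`p₀ > 0`); the lift's defect constant picks up
`(K + 2)²`, the radii `r_K = (C₂(B₄² + B₃B₄ + B₃³)L^{3m_F}/γ)(K + 2)²(√(L⁻¹))^K` stay summable (`T3SplitLog`-style).  Hypothesis schemas never asserted.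

References: T. Bałaban, CMP 102 (1985) 277–309 [Balaban1985Variational] (Thm 1 (8)–(10) p.279, Prop 8 p.304); C. King, CMP 103 (1986) 323–349 [King1986]
((A.5) p.676); T. Bałaban, CMP 99 (1985) 75–102 [Balaban1985RegularSpaces] (Thm 2 (1.36) p.82, p.83).
-/

noncomputable section

open MeasureTheory Filter Topology
open scoped Matrix.Norms.L2Operator
open Literature.MathematicalPhysics.QuantumFieldTheory.Balaban1983to89.T3ContinuumYM3Torus
open Literature.MathematicalPhysics.QuantumFieldTheory.Balaban1983to89.T3UnitLawDensityEML (ℰp measurableE_ℰp)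
open Literature.MathematicalPhysics.QuantumFieldTheory.Balaban1983to89.T3UnitScaleTilt
open Literature.MathematicalPhysics.QuantumFieldTheory.Balaban1983to89.T3TiltDescent
open Literature.MathematicalPhysics.QuantumFieldTheory.Balaban1983to89.T3CruxEstimates
open Literature.MathematicalPhysics.QuantumFieldTheory.Balaban1983to89.T3ConstrainedMinimiser
open Literature.MathematicalPhysics.QuantumFieldTheory.Balaban1983to89.T3DescentFibreTower
open Literature.MathematicalPhysics.QuantumFieldTheory.Balaban1983to89.T3MinimiserStabilityReduction
open Literature.MathematicalPhysics.QuantumFieldTheory.Balaban1983to89.T3RegularMinimiser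
open Literature.MathematicalPhysics.QuantumFieldTheory.Balaban1983to89.T3PrintedRegularMinimiser
open Literature.MathematicalPhysics.QuantumFieldTheory.Balaban1983to89.T3PrintedRegularMinimiserReduction
open Literature.MathematicalPhysics.QuantumFieldTheory.Balaban1983to89.T3PrintedMinimiserExistence
open Literature.MathematicalPhysics.QuantumFieldTheory.Balaban1983to89.T3Thresholds
open Literature.MathematicalPhysics.QuantumFieldTheory.Balaban1983to89.T3LowerAlongMinimisersSplit
open Literature.MathematicalPhysics.QuantumFieldTheory.Balaban1983to89.T3AvgDivergenceSplit
open Literature.MathematicalPhysics.QuantumFieldTheory.Balaban1983to89.T3UpperAlongMinimisersSplit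
open Literature.MathematicalPhysics.QuantumFieldTheory.Balaban1983to89.T3UpperLiftSplit
open Literature.MathematicalPhysics.QuantumFieldTheory.Balaban1983to89.T3CurvGradLog
open Literature.MathematicalPhysics.QuantumFieldTheory.Balaban1983to89.B10Eq27TorusAxialLog (toUField unitsField)
open Literature.MathematicalPhysics.QuantumFieldTheory.Balaban1983to89.B10Eq68TorusRegularity (plaqFT covDerivT covDivT)
open Literature.MathematicalPhysics.QuantumFieldTheory.Balaban1983to89.Missing

namespace Literature.MathematicalPhysics.QuantumFieldTheory.Balaban1983to89.T3UpperLiftSplitLog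

/-! ## §1 Arithmetic -/

section Arithmetic

variable (F : T3Family)

/-- `d − 1 = 2` for the family (bookkeeping). [cite: Balaban1985UV3, (1)-(3) p.256] -/
private theorem d_sub_one_cast (K : ℕ) : (((F.P K).d - 1 : ℕ) : ℝ) = 2 := by
  rw [T3Family.P_d]; norm_num

/-- The radii `r_K = c·(K + 2)²·(√(L⁻¹))^K` are summable (`L > 1`). [folklore] -/
private theorem summable_sq_mul_sqrt_geometric' (c : ℝ) :
    Summable (fun K : ℕ => c * ((K : ℝ) + 2) ^ 2 * (Real.sqrt ((F.L : ℝ)⁻¹)) ^ K) := by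
  have hL1 : (1 : ℝ) < F.L := by exact_mod_cast F.hL.2
  set q : ℝ := Real.sqrt ((F.L : ℝ)⁻¹) with hq_def
  have hq0 : 0 ≤ q := Real.sqrt_nonneg _
  have hq1 : q < 1 := (Real.sqrt_lt_sqrt (inv_pos.mpr (L_cast_pos F)).le (inv_lt_one_of_one_lt₀ hL1)).trans_eq Real.sqrt_one
  have hnorm : ‖q‖ < 1 := by rw [Real.norm_of_nonneg hq0]; exact hq1
  have h2 : Summable (fun K : ℕ => (K : ℝ) ^ 2 * q ^ K) := summable_pow_mul_geometric_of_norm_lt_one 2 hnorm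
  have h1 : Summable (fun K : ℕ => (K : ℝ) ^ 1 * q ^ K) := summable_pow_mul_geometric_of_norm_lt_one 1 hnorm
  have h0 : Summable (fun K : ℕ => q ^ K) := summable_geometric_of_lt_one hq0 hq1
  have hsum : Summable (fun K : ℕ => (K : ℝ) ^ 2 * q ^ K + 4 * ((K : ℝ) ^ 1 * q ^ K) + 4 * q ^ K) :=
    (h2.add (h1.mul_left 4)).add (h0.mul_left 4)
  refine (hsum.mul_left c).congr fun K => ?_
  ring

end Arithmetic

/-! ## §2 UPPER's regular lift from the weakened schema -/

section Upper

/-- **G-K1a-2 ⇐ THE WEAKENED SCHEMA ∧ G-K1a-2′** (PROVED; log twin of `T3UpperLiftSplit.regularLiftAlongMinimisersAt_of_split`): for `0 < ε₀ ≤ a₀`,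
`m ≥ 10`, `b₀, p₀ > 0` there is `γ₁ > 0` with `RegularLiftAlongMinimisersAt F γ b₀ p₀ m ε₀ B₃` for all `F` with `F.L = L`, `0 < γ ≤ γ₁`; `K₀ = 1`,
`r_K = (C₂(B₄² + B₃B₄ + B₃³)L^{3m_F}/γ)(K + 2)²(√(L⁻¹))^K`.  The `γ₁` puts `(K + 2)·θBal(⌊K/m⌋)` below `min {1, a₁, ε₀/B₃, c/B₃, c/B₄, ε₀x²/(2C₁(B₃+B₄)),
ε₀x³/(4C₁(B₄+B₃²))}`, which covers the lift's plaquette and divergence clauses with the gradient input `b = B₄θ((K−⌊K/m⌋)+1)L^{−3(K−⌊K/m⌋)}`.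
[cite: Balaban1985Variational, Thm 1 (8)-(10) p.279; King1986, (A.5) p.676] -/
theorem regularLiftAlongMinimisersAt_of_splitLog {L : ℕ} {a₀ a₁ B₃ B₄ C₁ C₂ c : ℝ} (ha₀ : 0 < a₀) (ha₁ : 0 < a₁) (hB₃ : 0 < B₃)
    (hB₄ : 0 < B₄) (hC₁ : 0 < C₁) (hC₂ : 0 ≤ C₂) (hc : 0 < c) (hgrad : MinimiserCurvGradLogAt L a₀ a₁ B₃ B₄) (hlift : SmoothLiftAt L C₁ C₂ c) :
    ∃ ε₁' : ℝ, 0 < ε₁' ∧ ∀ ε₀ : ℝ, 0 < ε₀ → ε₀ ≤ ε₁' → ∀ m : ℕ, 10 ≤ m → ∀ b₀ p₀ : ℝ, 0 < b₀ → 0 < p₀ →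
      ∃ γ₁ : ℝ, 0 < γ₁ ∧ ∀ (F : T3Family) (γ : ℝ), F.L = L → 0 < γ → γ ≤ γ₁ →
        RegularLiftAlongMinimisersAt F γ b₀ p₀ m ε₀ B₃ := by
  refine ⟨a₀, ha₀, fun ε₀ hε₀ hε₀a m hm b₀ p₀ hb hp => ?_⟩
  by_cases hL : 1 < L
  · have hL0 : (0 : ℝ) < (L : ℝ) := by exact_mod_cast (zero_lt_one.trans hL)
    set σ : ℝ := min 1 (min a₁ (min (ε₀ / B₃) (min (c / B₃) (min (c / B₄)
      (min (ε₀ * ((L : ℝ)⁻¹) ^ 2 / (2 * C₁ * (B₃ + B₄))) (ε₀ * ((L : ℝ)⁻¹) ^ 3 / (4 * C₁ * (B₄ + B₃ ^ 2)))))))) with hσ_def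
    have hσ : 0 < σ :=
      lt_min one_pos (lt_min ha₁ (lt_min (by positivity) (lt_min (by positivity) (lt_min (by positivity)
        (lt_min (by positivity) (by positivity))))))
    obtain ⟨γ₁, hγ₁, hγ₁1, hθ⟩ := exists_gamma_forall_Kmul_θBal_le hL hb hp (by omega : 0 < m) hσ
    refine ⟨γ₁, hγ₁, fun F γ hF hγ hγle => ?_⟩
    subst hF
    have hγ1 : γ ≤ 1 := hγle.trans hγ₁1
    have hFL : 1 ≤ F.L := F.hL.2.le
    have hLF : (0 : ℝ) < F.L := L_cast_pos F
    set M : ℝ := C₂ * (B₄ ^ 2 + B₃ * B₄ + B₃ ^ 3) with hM_def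
    have hM : 0 ≤ M := by positivity
    refine ⟨1, fun K => (M * (F.L : ℝ) ^ (3 * F.m) / γ) * ((K : ℝ) + 2) ^ 2 * (Real.sqrt ((F.L : ℝ)⁻¹)) ^ K,
      summable_sq_mul_sqrt_geometric' F _, fun K => by positivity, fun K hK V hV U hU8 hmin => ?_⟩
    have hnK : K / m < K := Nat.div_lt_self (by omega) (by omega)
    -- `θ`, `τ = (K+2)θ` and the thresholds
    set θ := θBal F.L γ b₀ p₀ (K / m) with hθ_def
    have hθ0 : 0 < θ := θBal_pos hFL hγ hγ1 hb p₀ (K / m)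
    have hτσ : ((K : ℝ) + 2) * θ ≤ σ := hθ γ hγ hγle K
    have hθσ : θ ≤ σ := θBal_le_of_Kmul_le hFL hγ hγ1 hb hτσ
    have hK2 : (1 : ℝ) ≤ (K : ℝ) + 2 := by have := Nat.cast_nonneg (α := ℝ) K; linarith
    have hθτ : θ ≤ ((K : ℝ) + 2) * θ := le_mul_of_one_le_left hθ0.le hK2
    have hθ1 : θ ≤ 1 := hθσ.trans (min_le_left _ _)
    have hθa₁ : θ ≤ a₁ := hθσ.trans ((min_le_right _ _).trans (min_le_left _ _))
    have hθ3 : θ ≤ ε₀ / B₃ := hθσ.trans ((min_le_right _ _).trans ((min_le_right _ _).trans (min_le_left _ _)))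
    have hθ4 : θ ≤ c / B₃ :=
      hθσ.trans ((min_le_right _ _).trans ((min_le_right _ _).trans ((min_le_right _ _).trans (min_le_left _ _))))
    have hτ5 : ((K : ℝ) + 2) * θ ≤ c / B₄ :=
      hτσ.trans ((min_le_right _ _).trans ((min_le_right _ _).trans ((min_le_right _ _).trans ((min_le_right _ _).trans
        (min_le_left _ _)))))
    have hτ6 : ((K : ℝ) + 2) * θ ≤ ε₀ * ((F.L : ℝ)⁻¹) ^ 2 / (2 * C₁ * (B₃ + B₄)) :=
      hτσ.trans ((min_le_right _ _).trans ((min_le_right _ _).trans ((min_le_right _ _).trans ((min_le_right _ _).trans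
        ((min_le_right _ _).trans (min_le_left _ _))))))
    have hτ7 : ((K : ℝ) + 2) * θ ≤ ε₀ * ((F.L : ℝ)⁻¹) ^ 3 / (4 * C₁ * (B₄ + B₃ ^ 2)) :=
      hτσ.trans ((min_le_right _ _).trans ((min_le_right _ _).trans ((min_le_right _ _).trans ((min_le_right _ _).trans
        ((min_le_right _ _).trans (min_le_right _ _))))))
    have hlo : B₃ * θ ≤ ε₀ := by
      have h := mul_le_mul_of_nonneg_left hθ3 hB₃.le
      rwa [mul_div_cancel₀ _ hB₃.ne'] at h
    have hBc : B₃ * θ ≤ c := by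
      have h := mul_le_mul_of_nonneg_left hθ4 hB₃.le
      rwa [mul_div_cancel₀ _ hB₃.ne'] at h
    have hB4c : B₄ * (((K : ℝ) + 2) * θ) ≤ c := by
      have h := mul_le_mul_of_nonneg_left hτ5 hB₄.le
      rwa [mul_div_cancel₀ _ hB₄.ne'] at h
    -- `kf = (K − ⌊K/m⌋) + 1 ≤ K + 2`, `B₄K = B₄·kf`
    set kf : ℝ := ((K - K / m : ℕ) : ℝ) + 1 with hkf_def
    have hkf2 : kf ≤ (K : ℝ) + 2 := by
      have : ((K - K / m : ℕ) : ℝ) ≤ (K : ℝ) := by exact_mod_cast Nat.sub_le K (K / m)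
      rw [hkf_def]; linarith
    set B₄K : ℝ := B₄ * kf with hB₄K_def
    have hB₄K0 : 0 ≤ B₄K := by positivity
    have hB₄K2 : B₄K ≤ B₄ * ((K : ℝ) + 2) := mul_le_mul_of_nonneg_left hkf2 hB₄.le
    have hB₄Kθ : B₄K * θ ≤ B₄ * (((K : ℝ) + 2) * θ) := by
      calc B₄K * θ ≤ B₄ * ((K : ℝ) + 2) * θ := mul_le_mul_of_nonneg_right hB₄K2 hθ0.le
        _ = B₄ * (((K : ℝ) + 2) * θ) := by ring
    -- `a = B₃θx^{2k}`, `b = B₄K θ x^{3k}`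
    set x : ℝ := (F.L : ℝ)⁻¹ with hx_def
    have hx : 0 < x := inv_pos.mpr hLF
    have hx1 : x ≤ 1 := inv_le_one_of_one_le₀ (by exact_mod_cast hFL)
    set a : ℝ := regThreshold F (K / m) K (B₃ * θ) with ha_def
    have ha_eq : a = B₃ * θ * x ^ (2 * (K - K / m)) := rfl
    set b : ℝ := B₄ * θ * (((K - K / m : ℕ) : ℝ) + 1) * x ^ (3 * (K - K / m)) with hb_def
    have hb' : b = B₄K * θ * x ^ (3 * (K - K / m)) := by rw [hb_def, hB₄K_def, hkf_def]; ring
    have hxk2 : x ^ (2 * (K - K / m)) ≤ 1 := pow_le_one₀ hx.le hx1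
    have hxk3 : x ^ (3 * (K - K / m)) ≤ 1 := pow_le_one₀ hx.le hx1
    have ha0 : 0 ≤ a := by rw [ha_eq]; positivity
    have hac : a ≤ c := by rw [ha_eq]; exact (mul_le_of_le_one_right (by positivity) hxk2).trans hBc
    have hb0 : 0 ≤ b := by rw [hb']; positivity
    have hbc : b ≤ c := by
      rw [hb']; exact (mul_le_of_le_one_right (by positivity) hxk3).trans (hB₄Kθ.trans hB4c)
    -- the weakened (9) for the minimiser, which lies in (6)(ε₀) ⊇ (8)
    have hU6 : U ∈ regFibrePr F (K / m) K (Nat.div_le_self K m) ε₀ V := regFibrePr_mono F hlo V hU8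
    have hder : ∀ (y : Site (F.P K) 0) (ν κ κ' : Fin (F.P K).d), κ ≠ κ' →
        ‖covDerivT 1 (unitsField (toUField U)) ν (plaqFT (unitsField (toUField U)) κ κ') y‖ ≤ b :=
      fun y ν κ κ' hne => (hgrad F rfl (K / m) K hnK θ ε₀ hθ0 hθa₁ hlo hε₀a V hV U hU6 hmin y ν κ κ' hne).le
    -- the smooth lift
    obtain ⟨U'', hD, hplaq, hder'', hact⟩ := hlift F rfl K a b ha0 hac hb0 hbc U hU8.1.2 hder
    refine ⟨U'', hD, ⟨?_, ?_⟩, ?_⟩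
    · -- plaquette clause at run `K+1`'s cut-off: `C₁(a + b) ≤ ε₀x^{2(k+1)}`
      refine plaqSmall_of_le ?_ hplaq
      have hk1 : 2 * (K + 1 - K / m) = 2 * (K - K / m) + 2 := by omega
      show C₁ * (a + b) ≤ ε₀ * x ^ (2 * (K + 1 - K / m))
      rw [hk1, pow_add, ha_eq, hb']
      have hsum : B₃ * θ * x ^ (2 * (K - K / m)) + B₄K * θ * x ^ (3 * (K - K / m)) ≤
          (B₃ + B₄) * (((K : ℝ) + 2) * θ) * x ^ (2 * (K - K / m)) := by
        have h32 : x ^ (3 * (K - K / m)) ≤ x ^ (2 * (K - K / m)) := pow_le_pow_of_le_one hx.le hx1 (by omega)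
        have h1 : B₄K * θ * x ^ (3 * (K - K / m)) ≤ B₄ * (((K : ℝ) + 2) * θ) * x ^ (2 * (K - K / m)) :=
          mul_le_mul hB₄Kθ h32 (pow_nonneg hx.le _) (by positivity)
        have h2 : B₃ * θ * x ^ (2 * (K - K / m)) ≤ B₃ * (((K : ℝ) + 2) * θ) * x ^ (2 * (K - K / m)) :=
          mul_le_mul_of_nonneg_right (mul_le_mul_of_nonneg_left hθτ hB₃.le) (pow_nonneg hx.le _)
        rw [show (B₃ + B₄) * (((K : ℝ) + 2) * θ) * x ^ (2 * (K - K / m)) =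
          B₃ * (((K : ℝ) + 2) * θ) * x ^ (2 * (K - K / m)) + B₄ * (((K : ℝ) + 2) * θ) * x ^ (2 * (K - K / m)) by ring]
        linarith only [h1, h2]
      have hτ6' : C₁ * ((B₃ + B₄) * (((K : ℝ) + 2) * θ)) ≤ ε₀ * x ^ 2 / 2 := by
        have hpos : 0 < 2 * C₁ * (B₃ + B₄) := by positivity
        have h := mul_le_mul_of_nonneg_left hτ6 hpos.le
        rw [mul_div_cancel₀ _ hpos.ne'] at h
        linarith only [h]
      calc C₁ * (B₃ * θ * x ^ (2 * (K - K / m)) + B₄K * θ * x ^ (3 * (K - K / m)))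
          ≤ C₁ * ((B₃ + B₄) * (((K : ℝ) + 2) * θ) * x ^ (2 * (K - K / m))) := mul_le_mul_of_nonneg_left hsum hC₁.le
        _ = C₁ * ((B₃ + B₄) * (((K : ℝ) + 2) * θ)) * x ^ (2 * (K - K / m)) := by ring
        _ ≤ (ε₀ * x ^ 2 / 2) * x ^ (2 * (K - K / m)) := mul_le_mul_of_nonneg_right hτ6' (by positivity)
        _ ≤ ε₀ * (x ^ (2 * (K - K / m)) * x ^ 2) := by
            rw [show (ε₀ * x ^ 2 / 2) * x ^ (2 * (K - K / m)) = (ε₀ * (x ^ (2 * (K - K / m)) * x ^ 2)) / 2 by ring]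
            exact half_le_self (by positivity)
    · -- divergence clause at run `K+1`'s cut-off: `2C₁(b + a²) < ε₀x^{3(k+1)}`
      intro bd
      have hdiv := norm_covDivT_le_of_covDerivT_le (unitsField (toUField U'')) (x := bd.src)
        (fun ν κ κ' hne => hder'' bd.src ν κ κ' hne) bd.dir
      rw [d_sub_one_cast] at hdiv
      refine hdiv.trans_lt ?_
      have hk1 : 3 * (K + 1 - K / m) = 3 * (K - K / m) + 3 := by omega
      show 2 * (C₁ * (b + a ^ 2)) < ε₀ * x ^ (3 * (K + 1 - K / m))
      rw [hk1, pow_add, ha_eq, hb']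
      have hsum : B₄K * θ * x ^ (3 * (K - K / m)) + (B₃ * θ * x ^ (2 * (K - K / m))) ^ 2 ≤
          (B₄ + B₃ ^ 2) * (((K : ℝ) + 2) * θ) * x ^ (3 * (K - K / m)) := by
        have h43 : x ^ (4 * (K - K / m)) ≤ x ^ (3 * (K - K / m)) := pow_le_pow_of_le_one hx.le hx1 (by omega)
        have hsq : (B₃ * θ * x ^ (2 * (K - K / m))) ^ 2 = B₃ ^ 2 * (θ * θ) * x ^ (4 * (K - K / m)) := by ring
        have hθθ : θ * θ ≤ ((K : ℝ) + 2) * θ := (mul_le_of_le_one_right hθ0.le hθ1).trans hθτ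
        rw [hsq]
        have h2 : B₃ ^ 2 * (θ * θ) * x ^ (4 * (K - K / m)) ≤ B₃ ^ 2 * (((K : ℝ) + 2) * θ) * x ^ (3 * (K - K / m)) :=
          mul_le_mul (mul_le_mul_of_nonneg_left hθθ (sq_nonneg B₃)) h43 (pow_nonneg hx.le _) (by positivity)
        have h1 : B₄K * θ * x ^ (3 * (K - K / m)) ≤ B₄ * (((K : ℝ) + 2) * θ) * x ^ (3 * (K - K / m)) :=
          mul_le_mul_of_nonneg_right hB₄Kθ (pow_nonneg hx.le _)
        rw [show (B₄ + B₃ ^ 2) * (((K : ℝ) + 2) * θ) * x ^ (3 * (K - K / m)) =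
          B₄ * (((K : ℝ) + 2) * θ) * x ^ (3 * (K - K / m)) + B₃ ^ 2 * (((K : ℝ) + 2) * θ) * x ^ (3 * (K - K / m)) by ring]
        linarith only [h1, h2]
      have hτ7' : 2 * (C₁ * ((B₄ + B₃ ^ 2) * (((K : ℝ) + 2) * θ))) ≤ ε₀ * x ^ 3 / 2 := by
        have hpos : 0 < 4 * C₁ * (B₄ + B₃ ^ 2) := by positivity
        have h := mul_le_mul_of_nonneg_left hτ7 hpos.le
        rw [mul_div_cancel₀ _ hpos.ne'] at h
        linarith only [h]
      have hx3k : 0 < x ^ (3 * (K - K / m)) := pow_pos hx _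
      calc 2 * (C₁ * (B₄K * θ * x ^ (3 * (K - K / m)) + (B₃ * θ * x ^ (2 * (K - K / m))) ^ 2))
          ≤ 2 * (C₁ * ((B₄ + B₃ ^ 2) * (((K : ℝ) + 2) * θ) * x ^ (3 * (K - K / m)))) := by gcongr
        _ = 2 * (C₁ * ((B₄ + B₃ ^ 2) * (((K : ℝ) + 2) * θ))) * x ^ (3 * (K - K / m)) := by ring
        _ ≤ (ε₀ * x ^ 3 / 2) * x ^ (3 * (K - K / m)) := mul_le_mul_of_nonneg_right hτ7' hx3k.le
        _ < ε₀ * (x ^ (3 * (K - K / m)) * x ^ 3) := by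
            rw [show (ε₀ * x ^ 3 / 2) * x ^ (3 * (K - K / m)) = (ε₀ * (x ^ (3 * (K - K / m)) * x ^ 3)) / 2 by ring]
            exact half_lt_self (by positivity)
    · -- the action: `β_{K+1}A(U″) = β_K·(L·A(U″)) ≤ β_K A(U) + β_K·defect ≤ β_K A(U) + r_K`
      have hβ : 0 ≤ (F.scheme ℰp γ).β K := by
        rw [scheme_β_eq]; exact (inv_pos.mpr (mul_pos hγ (pow_pos hx K))).le
      rw [scheme_β_succ, show (F.L : ℝ) * (F.scheme ℰp γ).β K * wilsonAction4 U'' =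
        (F.scheme ℰp γ).β K * ((F.L : ℝ) * wilsonAction4 U'') by ring]
      set MK : ℝ := M * ((K : ℝ) + 2) ^ 2 with hMK_def
      have hMK : 0 ≤ MK := by positivity
      have hK2sq : (1 : ℝ) ≤ ((K : ℝ) + 2) ^ 2 := one_le_pow₀ hK2
      have hdef : C₂ * (b ^ 2 + a * b + a ^ 3) ≤ MK * θ ^ 2 * x ^ (5 * (K - K / m)) := by
        have h0 : C₂ * (b ^ 2 + a * b + a ^ 3) ≤ C₂ * (B₄K ^ 2 + B₃ * B₄K + B₃ ^ 3) * θ ^ 2 * x ^ (5 * (K - K / m)) := by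
          rw [hb', ha_eq]; exact defect_le F (B₄ := B₄K) hB₃.le hC₂ hθ1 (K - K / m)
        have h1 : B₄K ^ 2 ≤ B₄ ^ 2 * ((K : ℝ) + 2) ^ 2 := by
          rw [← mul_pow]; exact pow_le_pow_left₀ hB₄K0 hB₄K2 2
        have h2 : B₃ * B₄K ≤ B₃ * B₄ * ((K : ℝ) + 2) ^ 2 := by
          calc B₃ * B₄K ≤ B₃ * (B₄ * ((K : ℝ) + 2)) := mul_le_mul_of_nonneg_left hB₄K2 hB₃.le
            _ = B₃ * B₄ * ((K : ℝ) + 2) := by ring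
            _ ≤ B₃ * B₄ * ((K : ℝ) + 2) * ((K : ℝ) + 2) := le_mul_of_one_le_right (by positivity) hK2
            _ = B₃ * B₄ * ((K : ℝ) + 2) ^ 2 := by ring
        have h3 : B₃ ^ 3 ≤ B₃ ^ 3 * ((K : ℝ) + 2) ^ 2 := le_mul_of_one_le_right (by positivity) hK2sq
        have hsum : B₄K ^ 2 + B₃ * B₄K + B₃ ^ 3 ≤ (B₄ ^ 2 + B₃ * B₄ + B₃ ^ 3) * ((K : ℝ) + 2) ^ 2 := by
          have hexp : (B₄ ^ 2 + B₃ * B₄ + B₃ ^ 3) * ((K : ℝ) + 2) ^ 2 =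
              B₄ ^ 2 * ((K : ℝ) + 2) ^ 2 + B₃ * B₄ * ((K : ℝ) + 2) ^ 2 + B₃ ^ 3 * ((K : ℝ) + 2) ^ 2 := by ring
          rw [hexp]; linarith [h1, h2, h3]
        have hcoef : C₂ * (B₄K ^ 2 + B₃ * B₄K + B₃ ^ 3) ≤ MK := by
          rw [hMK_def, hM_def]
          calc C₂ * (B₄K ^ 2 + B₃ * B₄K + B₃ ^ 3) ≤ C₂ * ((B₄ ^ 2 + B₃ * B₄ + B₃ ^ 3) * ((K : ℝ) + 2) ^ 2) :=
                mul_le_mul_of_nonneg_left hsum hC₂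
            _ = C₂ * (B₄ ^ 2 + B₃ * B₄ + B₃ ^ 3) * ((K : ℝ) + 2) ^ 2 := by ring
        calc C₂ * (b ^ 2 + a * b + a ^ 3) ≤ C₂ * (B₄K ^ 2 + B₃ * B₄K + B₃ ^ 3) * θ ^ 2 * x ^ (5 * (K - K / m)) := h0
          _ = C₂ * (B₄K ^ 2 + B₃ * B₄K + B₃ ^ 3) * (θ ^ 2 * x ^ (5 * (K - K / m))) := by ring
          _ ≤ MK * (θ ^ 2 * x ^ (5 * (K - K / m))) := mul_le_mul_of_nonneg_right hcoef (by positivity)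
          _ = MK * θ ^ 2 * x ^ (5 * (K - K / m)) := by ring
      have hstep : (F.scheme ℰp γ).β K * ((F.L : ℝ) * wilsonAction4 U'') ≤
          (F.scheme ℰp γ).β K * wilsonAction4 U +
            (F.scheme ℰp γ).β K * (MK * θ ^ 2 * x ^ (5 * (K - K / m)) * (F.L : ℝ) ^ (3 * (F.m + K))) := by
        rw [← mul_add]
        refine mul_le_mul_of_nonneg_left (hact.trans (add_le_add le_rfl ?_)) hβ
        exact mul_le_mul_of_nonneg_right hdef (by positivity)
      refine hstep.trans (add_le_add le_rfl ((beta_mul_defect_le F hm hγ hMK hθ0.le hθ1 K).trans_eq ?_))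
      rw [hMK_def]; ring
  · refine ⟨1, one_pos, fun F γ hF _ _ => ?_⟩
    exact absurd (hF ▸ F.hL.2) hL

/-- **UPPER itself from the weakened schema** (`UpperAlongRegPrMinimisersAt`, through the tree's `upperAlongRegPrMinimisersAt_of_split`): for
`0 < ε₀ ≤ a₀`, `m ≥ 10`, `b₀, p₀ > 0`, small `γ`. [cite: Balaban1985Variational, Thm 1 (8)-(10) p.279 and Prop 8 p.304] -/
theorem upperAlongRegPrMinimisersAt_of_splitLog' {L : ℕ} {a₀ a₁ B₃ B₄ C₁ C₂ c : ℝ} (ha₀ : 0 < a₀) (ha₁ : 0 < a₁) (hB₃ : 0 < B₃)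
    (hB₄ : 0 < B₄) (hC₁ : 0 < C₁) (hC₂ : 0 ≤ C₂) (hc : 0 < c) (h8 : MinimisersIn8At L a₀ a₁ B₃)
    (hgrad : MinimiserCurvGradLogAt L a₀ a₁ B₃ B₄) (hlift : SmoothLiftAt L C₁ C₂ c) :
    ∃ ε₁' : ℝ, 0 < ε₁' ∧ ∀ ε₀ : ℝ, 0 < ε₀ → ε₀ ≤ ε₁' → ∀ m : ℕ, 10 ≤ m → ∀ b₀ p₀ : ℝ, 0 < b₀ → 0 < p₀ →
      ∃ γ₁ : ℝ, 0 < γ₁ ∧ ∀ (F : T3Family) (γ : ℝ), F.L = L → 0 < γ → γ ≤ γ₁ →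
        UpperAlongRegPrMinimisersAt F γ b₀ p₀ m ε₀ := by
  obtain ⟨e₁, he₁, H₁⟩ := upperAlongRegPrMinimisersAt_of_split ha₀ ha₁ hB₃ h8
  obtain ⟨e₂, he₂, H₂⟩ := regularLiftAlongMinimisersAt_of_splitLog ha₀ ha₁ hB₃ hB₄ hC₁ hC₂ hc hgrad hlift
  refine ⟨min e₁ e₂, lt_min he₁ he₂, fun ε₀ hε₀ hle m hm b₀ p₀ hb hp => ?_⟩
  obtain ⟨γa, hγa, hA⟩ := H₁ ε₀ hε₀ (hle.trans (min_le_left _ _)) m (le_trans (by norm_num) hm) b₀ p₀ hb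
  obtain ⟨γb, hγb, hB⟩ := H₂ ε₀ hε₀ (hle.trans (min_le_right _ _)) m hm b₀ p₀ hb hp
  refine ⟨min γa γb, lt_min hγa hγb, fun F γ hF hγ hγle => ?_⟩
  exact hA F γ hF hγ (hγle.trans (min_le_left _ _)) (hB F γ hF hγ (hγle.trans (min_le_right _ _)))

end Upper

end Literature.MathematicalPhysics.QuantumFieldTheory.Balaban1983to89.T3UpperLiftSplitLog

end
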